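import Summits.CriticalPhenomena.PercolationContinuityZ3.Theorems.PercNearOneGluingNoHeavyQuantIndepBlobCloudComponents
import HarnessLib

/-!
# QUANT lane R8, Conjecture DIB\* for BIG LIGHTS: every light blob alone exceeds the heavy shortfall over the floor
# (`x·a_k > 2j − C_H`), any number of lights, every floor `0 < x < 1` — the STAR decomposition of the light cloud

builds on p205010 (kernel theorem, internal audit signed; external expert review pending)

Support file (`--supports stmt-CriticalPhenomena-4575`), QUANT lane census seat prim-quant-census-1 (gen 15), rung R8 of
`run/shared/lean/prim/quant/LADDER.md`; memo `run/shared/lean/prim/quant/prim-quant-census-1/SMALL-CLOUD-G15.md` §8.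
Theorems only, no definitions, no sorries, standard axioms.  Part (III) of `…QuantIndepBlobCloudComponents` /
`…QuantIndepBlobSmallCloud` (the small-cloud family `M ≤ j` and the cloud-decomposition certificate `tail_ge_of_cloudDec`).

SETTING (as in parts I–II).  Blobs `k : κ`, sizes `a k ∈ ℕ`, gates `p k ∈ [0,1]`, floor `x`; a cloud `L` of lights (`p k < x`), the
other blobs heavy (`x ≤ p k`); heavy budget `C_H = Σ_{k ∉ L} a k·p k`, SHORTFALL `Cp = 2j − C_H`; restricted heavy tail `TL(t)`.

THE STAR DECOMPOSITION.  Suppose every light outcome is sure-certified except the empty one: `2·a_k > Cp` for every light `k`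
(then every non-empty set `S` of open lights has `2·a(S) > Cp`, so `TL(j+1−a(S)) ≥ x` by the heavy + sure row).  The only deficient
atom of the cloud law is `Λ = 0` (mass `m₀ = Π_L (1 − p_k)`), and it is carried by the SINGLE-OPEN outcomes `{l}` (mass
`m_l = odds(p_l)·m₀`) of a set `B` of CARRIERS through the light components `(0, a_l, γ_l)`: feasible iff `Σ_{l ∈ B} odds(p_l)/odds(γ_l) ≥ 1`
for certified gates `γ_l`.  With `γ_l` just above the minimal certified gate `x² + (1 − x)·Cp/a_l` (a light gate iff `Cp < x·a_l`), the
ONE-DIMENSIONAL LEMMA `odds(g)/odds(γ) ≥ (g − x²)/(γ − x²)` (`g ≤ γ < x`; the identity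
`g(1−γ)(γ−x²) − γ(1−g)(g−x²) = (γ−g)(x²−gγ)`) bounds each term below by `c_l/Cp` (`c_l = a_l·κ_x(p_l)` the light's DIB\* credit), so
the carriers' credit `Σ_B c_l > Cp` suffices.

* `Quant.IndepBlob.odds_div_odds_ge` — the one-dimensional lemma.
* `Quant.IndepBlob.tail_ge_of_bigLights` — **floor `0 < x < 1`; cloud gates `< x`; every light `k ∈ L` has `2j < C_H + 2·a_k`; a carrier
  set `B ⊆ L` with `a_l ≤ j`, `x² ≤ p_l`, `2j < C_H + x·a_l` on `B` and `2j < C_H + Σ_{l ∈ B} a_l·κ_x(p_l)` ⟹ `x ≤ P(N ≥ j+1)`.**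
* `Quant.IndepBlob.dibStar_of_bigLights` — **Conjecture DIB\* in its own binder shape for every instance in which EACH light blob
  satisfies `x·a_k > 2j − Σ_{heavy} a·g`** (each light alone is bigger than the shortfall over the floor; lights below `x²` allowed and
  discounted as in DIB\*): any number of lights, every floor `0 < x < 1`.  Orthogonal to the small-cloud family (there `Σ_L a ≤ j`; here
  e.g. several size-`j` lights at a shortfall `< x·j`); census (memo §8, `bigcover.py`, 43 495 random corner clouds with `Σ_L a > j`):
  20.1 % at the hardest admissible shortfall, 76.5 % at half of it.

[this work; this lane's census]; the gluing rows served: [cite: KozmaNitzan2024, Conjecture 3 (p. 15)]; product weights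
[cite: Grimmett1999, §1.3 p. 10].
-/

namespace Summit.CriticalPhenomena.PercolationContinuityZ3.Theorems

namespace Quant

namespace IndepBlob

open Finset

variable {κ : Type*} [Fintype κ] [DecidableEq κ]

/-! ### 6. The one-dimensional lemma -/

/-- **`odds(g)/odds(γ) ≥ (g − x²)/(γ − x²)` for `g ≤ γ < x < 1`, `x² < γ`** — from the identity
`g(1 − γ)(γ − x²) − γ(1 − g)(g − x²) = (γ − g)(x² − gγ)` and `gγ ≤ γ² < x²`. [this work] -/
theorem odds_div_odds_ge (x g γ : ℝ) (hgγ : g ≤ γ) (hγx : γ < x) (hx1 : x < 1) (hx2γ : x ^ 2 < γ) :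
    (g - x ^ 2) / (γ - x ^ 2) ≤ g / (1 - g) * ((1 - γ) / γ) := by
  have hγ0 : 0 < γ := lt_of_le_of_lt (sq_nonneg x) hx2γ
  have h1g : 0 < 1 - g := by linarith
  have hden : 0 < γ - x ^ 2 := by linarith
  rw [div_mul_div_comm, div_le_div_iff₀ hden (mul_pos h1g hγ0)]
  have key : g * (1 - γ) * (γ - x ^ 2) - (g - x ^ 2) * ((1 - g) * γ) = (γ - g) * (x ^ 2 - g * γ) := by ring
  have h1 : g * γ ≤ γ * γ := mul_le_mul_of_nonneg_right hgγ hγ0.le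
  have h2 : γ * γ < x * x := mul_lt_mul'' hγx hγx hγ0.le hγ0.le
  have h3 : 0 ≤ (γ - g) * (x ^ 2 - g * γ) := mul_nonneg (sub_nonneg.2 hgγ) (by nlinarith)
  linarith

/-! ### 7. Big lights: the star decomposition -/

/-- **DIB\* FOR BIG LIGHTS (cloud form).**  See the module docstring: lights `2·a_k > Cp` (`Cp = 2j − C_H`), carriers `B ⊆ L` with
`a_l ≤ j`, `x² ≤ p_l`, `x·a_l > Cp` and credit `Σ_B a_l·κ_x(p_l) > Cp` ⟹ `x ≤ P(N ≥ j+1)`. [this work] -/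
theorem tail_ge_of_bigLights (p : κ → ℝ) (a : κ → ℕ) (x : ℝ) (hx0 : 0 < x) (hx1 : x < 1)
    (hp0 : ∀ k, 0 ≤ p k) (hp1 : ∀ k, p k ≤ 1) (L : Finset κ) (hheavy : ∀ k, k ∉ L → x ≤ p k)
    (hlight : ∀ k ∈ L, p k < x) (j : ℕ)
    (hmid : ∀ k ∈ L, (2 * j : ℝ) < (∑ i ∈ Finset.univ \ L, (a i : ℝ) * p i) + 2 * (a k : ℝ))
    (B : Finset κ) (hBL : B ⊆ L) (hBj : ∀ k ∈ B, a k ≤ j) (hBx2 : ∀ k ∈ B, x ^ 2 ≤ p k)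
    (hBbig : ∀ k ∈ B, (2 * j : ℝ) < (∑ i ∈ Finset.univ \ L, (a i : ℝ) * p i) + x * (a k : ℝ))
    (hcredit : (2 * j : ℝ) < (∑ i ∈ Finset.univ \ L, (a i : ℝ) * p i) + ∑ k ∈ B, (a k : ℝ) * ((p k - x ^ 2) / (1 - x))) :
    x ≤ ∑ s : Finset κ, (∏ k, if k ∈ s then p k else 1 - p k) * (if j + 1 ≤ ∑ k ∈ s, a k then (1 : ℝ) else 0) := by
  have h1x : 0 < 1 - x := by linarith
  set U : Finset κ := Finset.univ \ L with hU
  set CH : ℝ := ∑ i ∈ U, (a i : ℝ) * p i with hCH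
  set TL : ℕ → ℝ := fun t => ∑ T ∈ U.powerset, (∏ k ∈ U, if k ∈ T then p k else 1 - p k) *
      (if t ≤ ∑ k ∈ T, a k then (1 : ℝ) else 0) with hTL
  set wL : Finset κ → ℝ := fun S => ∏ k ∈ L, if k ∈ S then p k else 1 - p k with hwL
  have hwL0 : ∀ S, 0 ≤ wL S := fun S => weightU_nonneg p L (fun k _ => hp0 k) (fun k _ => hp1 k) S
  have hTLnn : ∀ t, 0 ≤ TL t := fun t => tailU_nonneg p a U (fun k _ => hp0 k) (fun k _ => hp1 k) t
  have hTL0 : TL 0 = 1 := tailU_zero p a U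
  have hTLanti : ∀ {t t' : ℕ}, t ≤ t' → TL t' ≤ TL t := fun htt =>
    tailU_antitone p a U (fun k _ => hp0 k) (fun k _ => hp1 k) htt
  -- cloud conditioning
  rw [tail_cloud_split p a L (j + 1)]
  change x ≤ ∑ S ∈ L.powerset, wL S * TL (j + 1 - ∑ k ∈ S, a k)
  -- Case 0: the heavies alone reach layer `j+1` with probability `≥ x`
  by_cases hTLx : x ≤ TL (j + 1)
  · calc x = ∑ S ∈ L.powerset, wL S * x := by rw [← Finset.sum_mul, sum_powerset_weight p L, one_mul]
      _ ≤ ∑ S ∈ L.powerset, wL S * TL (j + 1 - ∑ k ∈ S, a k) :=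
          Finset.sum_le_sum fun S _ => mul_le_mul_of_nonneg_left (hTLx.trans (hTLanti (Nat.sub_le _ _))) (hwL0 S)
  push Not at hTLx
  -- the empty cloud is excluded (then the credit is the heavy budget and Case 0 applies)
  rcases L.eq_empty_or_nonempty with hL0 | ⟨ℓ₀, hℓ₀⟩
  · exfalso
    have hB0 : B = ∅ := Finset.subset_empty.1 (hL0 ▸ hBL)
    rw [hB0, Finset.sum_empty, add_zero] at hcredit
    have hU0 : U = Finset.univ := by rw [hU, hL0, Finset.sdiff_empty]
    have hfloor : ∀ k, a k ≠ 0 → x ≤ p k := fun k _ => hheavy k (by rw [hL0]; exact Finset.notMem_empty k)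
    have hbudget : (2 * j : ℝ) < 2 * ((0 : ℕ) : ℝ) + ∑ k, (a k : ℝ) * p k := by
      rw [Nat.cast_zero, mul_zero, zero_add, ← hU0]; exact hcredit
    have key := RootDec.term_ge_of_budget 0 a p j x hx1.le (fun k => ⟨hp0 k, hp1 k⟩) hfloor hbudget
    simp only [zero_add] at key
    have e : TL (j + 1) = ∑ W : Finset κ, (∏ k, if k ∈ W then p k else 1 - p k) * (if j + 1 ≤ ∑ k ∈ W, a k then (1 : ℝ) else 0) := by
      simp only [hTL, hU0]
      exact tailU_univ p a (j + 1)
    rw [← e] at key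
    linarith
  -- the shortfall is nonnegative (else the heavy row gives Case 0)
  have hCp0 : CH ≤ 2 * j := by
    by_contra h
    push Not at h
    have key := cloud_component_row p a x hx0 hx1 hp0 hp1 L ℓ₀ hℓ₀ hheavy j 0 0 0 le_rfl zero_le_one le_rfl (Nat.zero_le _)
      (by simp only [Nat.sub_self, Nat.cast_zero, zero_mul, mul_zero, add_zero]; exact h)
    rw [Nat.sub_zero, zero_mul, sub_zero, one_mul, zero_add] at key
    linarith
  -- every non-empty light outcome is certified by its sure mass
  have hsure : ∀ S ∈ L.powerset, S ≠ ∅ → x ≤ TL (j + 1 - ∑ k ∈ S, a k) := by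
    intro S hS hne
    have hSL : S ⊆ L := Finset.mem_powerset.1 hS
    obtain ⟨k, hk⟩ := Finset.nonempty_iff_ne_empty.2 hne
    have hak : a k ≤ ∑ i ∈ S, a i := Finset.single_le_sum (fun i _ => Nat.zero_le _) hk
    by_cases hbig : j + 1 ≤ ∑ i ∈ S, a i
    · have e : j + 1 - ∑ i ∈ S, a i = 0 := by omega
      rw [e, hTL0]; exact hx1.le
    · push Not at hbig
      have hle : ∑ i ∈ S, a i ≤ j := by omega
      have hcr : (2 * j : ℝ) < CH + 2 * ((∑ i ∈ S, a i : ℕ) : ℝ) +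
          ((∑ i ∈ S, a i - ∑ i ∈ S, a i : ℕ) : ℝ) * (if x ≤ (0 : ℝ) then (0 : ℝ) else (0 - x ^ 2) / (1 - x)) := by
        rw [Nat.sub_self, Nat.cast_zero, zero_mul, add_zero]
        have h1 := hmid k (hSL hk)
        have h2 : ((a k : ℕ) : ℝ) ≤ ((∑ i ∈ S, a i : ℕ) : ℝ) := Nat.cast_le.2 hak
        linarith
      have key := cloud_component_row p a x hx0 hx1 hp0 hp1 L ℓ₀ hℓ₀ hheavy j (∑ i ∈ S, a i) (∑ i ∈ S, a i) 0 le_rfl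
        zero_le_one le_rfl hle hcr
      rw [zero_mul, zero_add, sub_zero, one_mul] at key
      exact key
  -- the carriers: shortfall, credit, gates
  set Cp : ℝ := 2 * j - CH with hCp
  have hCp0' : 0 ≤ Cp := by rw [hCp]; linarith
  set c : κ → ℝ := fun k => (a k : ℝ) * ((p k - x ^ 2) / (1 - x)) with hc
  set σ : ℝ := ∑ k ∈ B, c k with hσ
  have hσ : Cp < σ := by rw [hCp, hσ]; linarith
  have hc0 : ∀ k ∈ B, 0 ≤ c k := fun k hk =>
    mul_nonneg (Nat.cast_nonneg _) (div_nonneg (sub_nonneg.2 (hBx2 k hk)) h1x.le)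
  set Cpl : κ → ℝ := fun k => Cp + min ((σ - Cp) / 2) ((x * a k - Cp) / 2) with hCpl
  set γ0 : κ → ℝ := fun k => x ^ 2 + (1 - x) * Cpl k / a k with hγ0
  set γ : κ → ℝ := fun k => max (γ0 k) (p k) with hγ
  have hBa0 : ∀ k ∈ B, (0 : ℝ) < a k := by
    intro k hk
    have h := hBbig k hk
    have : 0 < x * (a k : ℝ) := by rw [hCp] at hCp0'; linarith
    exact pos_of_mul_pos_right this hx0.le  -- hmm
  have hCplCp : ∀ k ∈ B, Cp < Cpl k := by
    intro k hk
    have h1 : 0 < (σ - Cp) / 2 := by linarith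
    have h2 : 0 < (x * a k - Cp) / 2 := by have := hBbig k hk; rw [hCp]; linarith
    show Cp < Cp + min ((σ - Cp) / 2) ((x * a k - Cp) / 2)
    have := lt_min h1 h2; linarith
  have hCplσ : ∀ k ∈ B, Cpl k ≤ (σ + Cp) / 2 := by
    intro k _
    show Cp + min ((σ - Cp) / 2) ((x * a k - Cp) / 2) ≤ (σ + Cp) / 2
    have := min_le_left ((σ - Cp) / 2) ((x * a k - Cp) / 2); linarith
  have hCplx : ∀ k ∈ B, Cpl k < x * a k := by
    intro k hk
    show Cp + min ((σ - Cp) / 2) ((x * a k - Cp) / 2) < x * a k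
    have := min_le_right ((σ - Cp) / 2) ((x * a k - Cp) / 2)
    have h2 := hBbig k hk
    linarith
  have hCplpos : ∀ k ∈ B, 0 < Cpl k := fun k hk => lt_of_le_of_lt hCp0' (hCplCp k hk)
  have hγ0x2 : ∀ k ∈ B, x ^ 2 < γ0 k := by
    intro k hk
    show x ^ 2 < x ^ 2 + (1 - x) * Cpl k / a k
    have := div_pos (mul_pos h1x (hCplpos k hk)) (hBa0 k hk); linarith
  have hγ0x : ∀ k ∈ B, γ0 k < x := by
    intro k hk
    show x ^ 2 + (1 - x) * Cpl k / a k < x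
    rw [← sub_pos]
    have ha : (a k : ℝ) ≠ 0 := (hBa0 k hk).ne'
    have e : x - (x ^ 2 + (1 - x) * Cpl k / a k) = (1 - x) * (x * a k - Cpl k) / a k := by
      field_simp
      ring
    rw [e]
    exact div_pos (mul_pos h1x (by linarith [hCplx k hk])) (hBa0 k hk)
  have hγx : ∀ k ∈ B, γ k < x := fun k hk => max_lt (hγ0x k hk) (hlight k (hBL hk))
  have hγge : ∀ k ∈ B, γ0 k ≤ γ k := fun k _ => le_max_left _ _
  have hγp : ∀ k ∈ B, p k ≤ γ k := fun k _ => le_max_right _ _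
  have hγpos : ∀ k ∈ B, 0 < γ k := fun k hk => lt_of_lt_of_le (lt_of_le_of_lt (sq_nonneg x) (hγ0x2 k hk)) (hγge k hk)
  have hγ1 : ∀ k ∈ B, γ k ≤ 1 := fun k hk => ((hγx k hk).trans hx1).le
  -- each carrier's component `(0, a_l, γ_l)` is certified: credit `a_l κ(γ_l) ≥ Cpl_l > Cp`
  have hbr : ∀ k ∈ B, x ≤ γ k * TL (j + 1 - a k) + (1 - γ k) * TL (j + 1) := by
    intro k hk
    have hcr : (2 * j : ℝ) < CH + 2 * ((0 : ℕ) : ℝ) +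
        ((a k - 0 : ℕ) : ℝ) * (if x ≤ γ k then γ k else (γ k - x ^ 2) / (1 - x)) := by
      rw [if_neg (not_le.2 (hγx k hk)), Nat.sub_zero, Nat.cast_zero, mul_zero, add_zero]
      have h1 : Cpl k ≤ (a k : ℝ) * ((γ0 k - x ^ 2) / (1 - x)) := by
        have e : (a k : ℝ) * ((γ0 k - x ^ 2) / (1 - x)) = Cpl k := by
          show (a k : ℝ) * ((x ^ 2 + (1 - x) * Cpl k / a k - x ^ 2) / (1 - x)) = Cpl k
          have ha : (a k : ℝ) ≠ 0 := (hBa0 k hk).ne'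
          have hx' : (1 - x) ≠ 0 := h1x.ne'
          field_simp
          ring
        rw [e]
      have h2 : (a k : ℝ) * ((γ0 k - x ^ 2) / (1 - x)) ≤ (a k : ℝ) * ((γ k - x ^ 2) / (1 - x)) :=
        mul_le_mul_of_nonneg_left (div_le_div_of_nonneg_right (by linarith [hγge k hk]) h1x.le) (Nat.cast_nonneg _)
      have h3 := hCplCp k hk
      rw [hCp] at h3
      linarith
    have key := cloud_component_row p a x hx0 hx1 hp0 hp1 L ℓ₀ hℓ₀ hheavy j 0 (a k) (γ k) (hγpos k hk).le (hγ1 k hk)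
      (Nat.zero_le _) (hBj k hk) hcr
    rw [Nat.sub_zero] at key
    exact key
  -- the odds bound per carrier: r_l = odds(p_l)·(1 − γ_l)/γ_l, and Σ_B r_l ≥ 1
  set r : κ → ℝ := fun k => p k / (1 - p k) * ((1 - γ k) / γ k) with hr
  have hr0 : ∀ k ∈ B, 0 ≤ r k := by
    intro k hk
    have : p k < 1 := (hlight k (hBL hk)).trans hx1
    exact mul_nonneg (div_nonneg (hp0 k) (by linarith)) (div_nonneg (by linarith [hγ1 k hk]) (hγpos k hk).le)
  have hrsum : 1 ≤ ∑ k ∈ B, r k := by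
    by_cases hsat : ∃ k ∈ B, γ0 k ≤ p k
    · obtain ⟨k, hk, hkγ⟩ := hsat
      have hγk : γ k = p k := max_eq_right hkγ
      have hpk0 : 0 < p k := lt_of_lt_of_le (lt_of_le_of_lt (sq_nonneg x) (hγ0x2 k hk)) hkγ
      have hpk1 : p k < 1 := (hlight k (hBL hk)).trans hx1
      have hrk : r k = 1 := by
        show p k / (1 - p k) * ((1 - γ k) / γ k) = 1
        rw [hγk, div_mul_div_comm, mul_comm (1 - p k) (p k)]
        exact div_self (mul_ne_zero hpk0.ne' (by linarith))
      rw [← hrk]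
      exact Finset.single_le_sum hr0 hk
    · push Not at hsat
      -- every carrier has `p_l < γ0_l = γ_l`: the one-dimensional lemma
      have hterm : ∀ k ∈ B, c k / ((σ + Cp) / 2) ≤ r k := by
        intro k hk
        have hγk : γ k = γ0 k := max_eq_left (hsat k hk).le
        have h1d := odds_div_odds_ge x (p k) (γ k) (hγp k hk) (hγx k hk) hx1 (by rw [hγk]; exact hγ0x2 k hk)
        -- `(p − x²)/(γ0 − x²) = c/Cpl`
        have e : (p k - x ^ 2) / (γ k - x ^ 2) = c k / Cpl k := by
          rw [hγk]
          show (p k - x ^ 2) / (x ^ 2 + (1 - x) * Cpl k / a k - x ^ 2) = (a k : ℝ) * ((p k - x ^ 2) / (1 - x)) / Cpl k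
          have ha := (hBa0 k hk).ne'
          have hC := (hCplpos k hk).ne'
          field_simp
          ring
        rw [e] at h1d
        have h2 : c k / ((σ + Cp) / 2) ≤ c k / Cpl k :=
          div_le_div_of_nonneg_left (hc0 k hk) (hCplpos k hk) (hCplσ k hk)
        exact h2.trans h1d
      have hsumc : ∑ k ∈ B, c k / ((σ + Cp) / 2) = σ / ((σ + Cp) / 2) := by rw [← Finset.sum_div]
      have h3 : 1 ≤ σ / ((σ + Cp) / 2) := by
        rw [le_div_iff₀ (by linarith)]; linarith
      calc (1 : ℝ) ≤ σ / ((σ + Cp) / 2) := h3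
        _ = ∑ k ∈ B, c k / ((σ + Cp) / 2) := hsumc.symm
        _ ≤ ∑ k ∈ B, r k := Finset.sum_le_sum hterm
  -- masses of the empty and the single-open outcomes
  set m0 : ℝ := wL ∅ with hm0
  have hm0nn : 0 ≤ m0 := hwL0 ∅
  have hsingle : ∀ k ∈ B, wL {k} * (1 - p k) = p k * m0 := by
    intro k hk
    have hkL : k ∈ L := hBL hk
    show (∏ i ∈ L, if i ∈ ({k} : Finset κ) then p i else 1 - p i) * (1 - p k) = p k * ∏ i ∈ L, if i ∈ (∅ : Finset κ) then p i else 1 - p i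
    rw [← Finset.mul_prod_erase L (fun i => if i ∈ ({k} : Finset κ) then p i else 1 - p i) hkL,
      ← Finset.mul_prod_erase L (fun i => if i ∈ (∅ : Finset κ) then p i else 1 - p i) hkL]
    have e1 : ∏ i ∈ L.erase k, (if i ∈ ({k} : Finset κ) then p i else 1 - p i) = ∏ i ∈ L.erase k, (1 - p i) :=
      Finset.prod_congr rfl fun i hi => by rw [if_neg (by rw [Finset.mem_singleton]; exact Finset.ne_of_mem_erase hi)]
    have e2 : ∏ i ∈ L.erase k, (if i ∈ (∅ : Finset κ) then p i else 1 - p i) = ∏ i ∈ L.erase k, (1 - p i) :=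
      Finset.prod_congr rfl fun i _ => by rw [if_neg (Finset.notMem_empty i)]
    rw [e1, e2, if_pos (Finset.mem_singleton_self k), if_neg (Finset.notMem_empty k)]
    ring
  -- per carrier: m_l (TL_l − x) ≥ m0 · r_l · (x − TL(j+1))
  have hcar : ∀ k ∈ B, m0 * r k * (x - TL (j + 1)) ≤ wL {k} * (TL (j + 1 - a k) - x) := by
    intro k hk
    have hpk1 : p k < 1 := (hlight k (hBL hk)).trans hx1
    have h1p : 0 < 1 - p k := by linarith
    have hγk := hγpos k hk
    -- rewrite `m0 · r` through the single-open mass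
    have e : m0 * r k = wL {k} * ((1 - γ k) / γ k) := by
      show m0 * (p k / (1 - p k) * ((1 - γ k) / γ k)) = wL {k} * ((1 - γ k) / γ k)
      have := hsingle k hk
      field_simp
      nlinarith [this]
    rw [e]
    have hb := hbr k hk
    have hw := hwL0 {k}
    -- `wL{k}·[(TL_l − x) − (1−γ)/γ·(x − TL(j+1))] = wL{k}/γ · [γ TL_l + (1−γ) TL(j+1) − x] ≥ 0`
    have e2 : wL {k} * (TL (j + 1 - a k) - x) - wL {k} * ((1 - γ k) / γ k) * (x - TL (j + 1)) =
        wL {k} / γ k * (γ k * TL (j + 1 - a k) + (1 - γ k) * TL (j + 1) - x) := by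
      field_simp
      ring
    have h3 : 0 ≤ wL {k} / γ k * (γ k * TL (j + 1 - a k) + (1 - γ k) * TL (j + 1) - x) :=
      mul_nonneg (div_nonneg hw hγk.le) (by linarith)
    linarith
  -- pointwise lower bound over the light outcomes
  have hpt : ∀ S ∈ L.powerset, wL S * x + (if S = ∅ then wL S * (TL (j + 1) - x) else 0) +
      (∑ k ∈ B, if S = {k} then wL S * (TL (j + 1 - a k) - x) else 0) ≤ wL S * TL (j + 1 - ∑ i ∈ S, a i) := by
    intro S hS
    by_cases hS0 : S = ∅
    · subst hS0
      have hz : ∑ k ∈ B, (if (∅ : Finset κ) = {k} then wL ∅ * (TL (j + 1 - a k) - x) else 0) = 0 :=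
        Finset.sum_eq_zero fun k _ => by rw [if_neg (Finset.singleton_ne_empty k).symm]
      rw [hz, if_pos rfl, Finset.sum_empty, Nat.sub_zero]
      linarith
    rw [if_neg hS0, add_zero]
    by_cases hS1 : ∃ k ∈ B, S = {k}
    · obtain ⟨k, hk, rfl⟩ := hS1
      have hz : ∑ i ∈ B, (if ({k} : Finset κ) = {i} then wL {k} * (TL (j + 1 - a i) - x) else 0) =
          wL {k} * (TL (j + 1 - a k) - x) := by
        have e : ∀ i ∈ B, (if ({k} : Finset κ) = {i} then wL {k} * (TL (j + 1 - a i) - x) else 0) =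
            (if k = i then wL {k} * (TL (j + 1 - a i) - x) else 0) := fun i _ => by simp only [Finset.singleton_inj]
        rw [Finset.sum_congr rfl e, Finset.sum_ite_eq B k, if_pos hk]
      rw [hz, Finset.sum_singleton]
      linarith
    · push Not at hS1
      have hz : ∑ k ∈ B, (if S = {k} then wL S * (TL (j + 1 - a k) - x) else 0) = 0 :=
        Finset.sum_eq_zero fun k hk => by rw [if_neg (hS1 k hk)]
      rw [hz, add_zero]
      exact mul_le_mul_of_nonneg_left (hsure S hS hS0) (hwL0 S)
  -- summing the pointwise bound
  have hsum := Finset.sum_le_sum hpt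
  rw [Finset.sum_add_distrib, Finset.sum_add_distrib, ← Finset.sum_mul, sum_powerset_weight p L, one_mul,
    Finset.sum_ite_eq' L.powerset (∅ : Finset κ), if_pos (Finset.empty_mem_powerset L), Finset.sum_comm] at hsum
  have hsing : ∑ k ∈ B, ∑ S ∈ L.powerset, (if S = {k} then wL S * (TL (j + 1 - a k) - x) else 0) =
      ∑ k ∈ B, wL {k} * (TL (j + 1 - a k) - x) := by
    refine Finset.sum_congr rfl fun k hk => ?_
    rw [Finset.sum_ite_eq' L.powerset ({k} : Finset κ), if_pos (Finset.mem_powerset.2 (Finset.singleton_subset_iff.2 (hBL hk)))]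
  rw [hsing] at hsum
  -- the carriers pay for the empty outcome
  have hpay : m0 * (x - TL (j + 1)) ≤ ∑ k ∈ B, wL {k} * (TL (j + 1 - a k) - x) := by
    have h1 : m0 * (x - TL (j + 1)) ≤ m0 * (x - TL (j + 1)) * ∑ k ∈ B, r k := by
      have hpos : 0 ≤ m0 * (x - TL (j + 1)) := mul_nonneg hm0nn (by linarith)
      nlinarith
    rw [Finset.mul_sum] at h1
    refine h1.trans (Finset.sum_le_sum fun k hk => ?_)
    have := hcar k hk
    linarith [this]
  have hm0e : wL ∅ = m0 := rfl
  rw [hm0e] at hsum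
  linarith

/-- **CONJECTURE DIB\* WHEN EVERY LIGHT BLOB ALONE EXCEEDS THE SHORTFALL OVER THE FLOOR** (DIB\*'s own binder shape): floor
`0 < x < 1`, gates in `[0,1]`, light blobs (`g k < x`) of size `≤ j` with `x·a_k > 2j − Σ_{x ≤ g} a·g` each, and the DIB\* credit
`2j < Σ_k a_k·(g_k | (g_k − x²)/(1 − x))` ⟹ `x ≤ P(Σ_{open} a ≥ j+1)`.  Carriers = the lights with `g ≥ x²`. [this work] -/
theorem dibStar_of_bigLights (x : ℝ) (hx0 : 0 < x) (hx1 : x < 1) (a : κ → ℕ) (g : κ → ℝ) (j : ℕ)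
    (hg : ∀ k, 0 ≤ g k ∧ g k ≤ 1) (hsize : ∀ k, g k < x → a k ≤ j)
    (hbig : ∀ k, g k < x → (2 * j : ℝ) < (∑ i ∈ Finset.univ.filter (fun i => x ≤ g i), (a i : ℝ) * g i) + x * (a k : ℝ))
    (hcredit : (2 * j : ℝ) < ∑ k, (a k : ℝ) * (if x ≤ g k then g k else (g k - x ^ 2) / (1 - x))) :
    x ≤ ∑ W : Finset κ, (∏ k, if k ∈ W then g k else 1 - g k) * (if j + 1 ≤ ∑ k ∈ W, a k then (1 : ℝ) else 0) := by
  have h1x : 0 < 1 - x := by linarith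
  set L : Finset κ := Finset.univ.filter (fun k => g k < x) with hL
  have hmemL : ∀ k, k ∈ L ↔ g k < x := fun k => by simp [hL]
  have hUeq : Finset.univ \ L = Finset.univ.filter (fun i => x ≤ g i) := by
    ext i; simp [hL, not_lt]
  set B : Finset κ := L.filter (fun k => x ^ 2 ≤ g k) with hB
  have hmemB : ∀ k, k ∈ B ↔ g k < x ∧ x ^ 2 ≤ g k := fun k => by simp [hB, hL]
  have hBL : B ⊆ L := Finset.filter_subset _ _
  -- the credit: heavy part + lights, and lights below `x²` only lower it
  have hsplit : ∑ k, (a k : ℝ) * (if x ≤ g k then g k else (g k - x ^ 2) / (1 - x)) =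
      (∑ k ∈ Finset.univ \ L, (a k : ℝ) * g k) + ∑ k ∈ L, (a k : ℝ) * ((g k - x ^ 2) / (1 - x)) := by
    rw [← Finset.sum_sdiff (Finset.subset_univ L)]
    congr 1
    · refine Finset.sum_congr rfl fun k hk => ?_
      have hkL : k ∉ L := (Finset.mem_sdiff.1 hk).2
      rw [if_pos (not_lt.1 fun h => hkL ((hmemL k).2 h))]
    · refine Finset.sum_congr rfl fun k hk => ?_
      rw [if_neg (not_le.2 ((hmemL k).1 hk))]
  have hLB : ∑ k ∈ L, (a k : ℝ) * ((g k - x ^ 2) / (1 - x)) ≤ ∑ k ∈ B, (a k : ℝ) * ((g k - x ^ 2) / (1 - x)) := by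
    rw [← Finset.sum_filter_add_sum_filter_not L (fun k => x ^ 2 ≤ g k)]
    have hneg : ∑ k ∈ L.filter (fun k => ¬ x ^ 2 ≤ g k), (a k : ℝ) * ((g k - x ^ 2) / (1 - x)) ≤ 0 :=
      Finset.sum_nonpos fun k hk => by
        have h := (Finset.mem_filter.1 hk).2
        push Not at h
        exact mul_nonpos_of_nonneg_of_nonpos (Nat.cast_nonneg _) (div_nonpos_of_nonpos_of_nonneg (by linarith) h1x.le)
    linarith
  rw [hsplit] at hcredit
  refine tail_ge_of_bigLights g a x hx0 hx1 (fun k => (hg k).1) (fun k => (hg k).2) L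
    (fun k hk => not_lt.1 fun h => hk ((hmemL k).2 h)) (fun k hk => (hmemL k).1 hk) j ?_ B hBL
    (fun k hk => hsize k ((hmemB k).1 hk).1) (fun k hk => ((hmemB k).1 hk).2) ?_ (by linarith)
  · intro k hk
    have h := hbig k ((hmemL k).1 hk)
    rw [← hUeq] at h
    have : x * (a k : ℝ) ≤ 2 * (a k : ℝ) := by nlinarith [(Nat.cast_nonneg (a k) : (0 : ℝ) ≤ (a k : ℝ))]
    linarith
  · intro k hk
    have h := hbig k ((hmemB k).1 hk).1
    rw [← hUeq] at h
    exact h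

end IndepBlob

end Quant

end Summit.CriticalPhenomena.PercolationContinuityZ3.Theorems
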